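import Literature.NumberTheory.Rogawski1990.DepthZeroKappaTransferTypeTwoRowZeroPlaceCount   -- ★ (B2c-I) p853395 (LH10-p01 (g11)): the level-one original and its imports (★ B-p12 frame, ★ (B2a), strata dictionary, ★ `ncard_fixedBy_sep_congr`)
import Literature.NumberTheory.Automorphic.UnitaryThreeBoundaryRigidityLevelTwo             -- ★ `isIntMatrix_smul_conj_sub_one` (conjugating a congruence to `1` by `GL₃(𝒪)`)
import Literature.NumberTheory.Automorphic.UnitaryLatticeTreeLevelShift                     -- ★ `map_sub_one_latt_le_scaleLattice_iff` (level in a basis, any `c ≠ 0`)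
import HarnessLib

/-!
# The level-two fixed cosets of a deep `δ` are a level-two place count (2-free)

Topic `NumberTheory/Rogawski1990`; namespace `Literature.NumberTheory.Rogawski1990`.  THEOREMS ONLY (no definition, no instance, no notation, no named fact, no `sorry`); kernel lane
`--supports stmt-HodgeConjecture-24833`.  Cell `pub/hodgecm-mathlib`, crux H413 = `stmt-HodgeConjecture-24833`, half-A line LH4; LEVEL-TWO row L2-6 of the D-UNR `h2`-map (LH4-p01 (g11)
CENSUS-LEVEL2-h2 v1): brick **(B2f)** of the dyadic twin BY COUNTING of ★ `exists_matched_pair_twoDeep_typeTwo` — the LEVEL-TWO twin of ★ (B2c-I)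
`ncard_rankStrata_zero_eq_ncard_isSelfDualLattice_stable_level_of_frame` (`DepthZeroKappaTransferTypeTwoRowZeroPlaceCount`, LH10-p01 (g11)), whose proof is followed line by line.
HONEST LABEL: HC_CM is proved only modulo the 7 printed citations (2 remaining named inputs: hLiu418 = stmt-HodgeConjecture-24832, h413 = stmt-HodgeConjecture-24833) until rung 0
closes; count-neutral assembly of ★ bricks; (D-UNR) stays PRINT.

THE MATHEMATICS.  As in ★ (B2c-I), with the residually-trivial predicate `rank(red(q⁻¹δq)_w − 1) = 0` (level ONE) replaced by the LEVEL-TWO predicate `(q⁻¹δq)_w ≡ 1 (mod ϖ²)`,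
spelled `IsIntMatrix ((ϖ²)⁻¹ • ((q⁻¹δq)_w − 1))` (★ T1a `UnitaryLatticeTree.IsIntMatrix`): through the frame `e g = T g_w T⁻¹`, `T ∈ GL₃(𝒪_w)` (★ B-p12) the predicate is carried by
★ `isIntMatrix_smul_conj_sub_one` (both ways, `T` and `T⁻¹` integral); it is invariant under `U ∩ GL₃(𝒪_w)`-conjugation (§0); on `U ⧸ (U ∩ GL₃(𝒪_w))` the fixed cosets with a
conjugation-invariant predicate are the self-dual `eδ`-fixed lattices with the matching lattice predicate (★ `ncard_fixedBy_quotient_sep_eq_ncard_selfDual_fixed_sep`, 2-free), the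
match being `IsIntMatrix ((ϖ²)⁻¹ • (g⁻¹(eδ)g − 1)) ⟺ (eδ − 1)·(g·L₀) ⊆ ϖ²·(g·L₀)` (§0, ★ `map_sub_one_latt_le_scaleLattice_iff`), and `eδ·M = M ⟺ eδ·M ⊆ M` (★ (B2a), `χ_δ` integral).

* §0 `isIntMatrix_smul_coe_conj_sub_one_iff`, `isIntMatrix_inv_smul_conj_sub_one_iff_map_sub_one_le`.
* §1 **`ncard_fixedBy_levelTwo_eq_ncard_isSelfDualLattice_stable_levelTwo_of_frame`**.

## References
* [Rogawski1990] J. D. Rogawski, *Automorphic Representations of Unitary Groups in Three Variables*, Ann. of Math. Stud. 123 (1990): §4.9 p. 54, Prop. 4.9.1 (b) p. 55.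
* [Kottwitz1986BaseChangeUnits] R. E. Kottwitz, *Base change for unit elements of Hecke algebras*, Compositio Math. 60 (1986): §1 pp. 240–241, §2 pp. 244–247.
* [Flicker1998UnitaryFL] Y. Z. Flicker, *Elementary proof of the fundamental lemma for a unitary group*, Canad. J. Math. 50 (1998): §3 Prop. 5 p. 82.
-/

set_option autoImplicit false

noncomputable section

open NumberField IsDedekindDomain Matrix Polynomial
open scoped MatrixGroups WithZero ValuativeRel

namespace Literature.NumberTheory.Rogawski1990

open Literature.NumberTheory.Automorphic Literature.NumberTheory.Automorphic.UnitaryGroup Literature.NumberTheory.Automorphic.IntegralReduction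
open Literature.NumberTheory.Automorphic.UnitaryLatticeTree Literature.NumberTheory.Automorphic.HermitianLattice Literature.NumberTheory.GaloisRepresentations Literature.NumberTheory.NumberFields

/-! ## §0 Two `IsIntMatrix` tokens: conjugation by `GL₃(𝒪_w)`, and the lattice reading of `≡ 1 (mod c)` -/

section Tokens

variable {K : Type*} [Field K] [Valued K (WithZero (Multiplicative ℤ))] {N : ℕ}

/-- `v(c⁻¹ x) ≤ 1 ↔ v x ≤ v c` (`c ≠ 0`). [cite: Kottwitz1986BaseChangeUnits, §2 pp. 244–247] -/
private theorem v_inv_mul_le_one_iff {c x : K} (hc : c ≠ 0) : Valued.v (c⁻¹ * x) ≤ 1 ↔ Valued.v x ≤ Valued.v c := by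
  have hvc : Valued.v c ≠ 0 := (Valuation.ne_zero_iff _).2 hc
  rw [map_mul, map_inv₀]
  constructor
  · intro h
    have h' := mul_le_mul_right h (Valued.v c)
    rwa [← mul_assoc, mul_inv_cancel₀ hvc, one_mul, mul_one] at h'
  · intro h
    have h' := mul_le_mul_right h (Valued.v c)⁻¹
    rwa [inv_mul_cancel₀ hvc] at h'

/-- **`≡ 1 (mod c⁻¹)` is invariant under `GL_N(𝒪)`-conjugation inside a subgroup `U`**: for `k ∈ U ∩ GL_N(𝒪)`,
`IsIntMatrix (c • ((k⁻¹ y k) − 1)) ↔ IsIntMatrix (c • (y − 1))` for `k, k⁻¹` integral (★ `isIntMatrix_smul_conj_sub_one` both ways). [cite: Kottwitz1986BaseChangeUnits, §2 pp. 244–247] -/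
theorem isIntMatrix_smul_coe_conj_sub_one_iff (U : Subgroup (GL (Fin N) K)) (c : K) {k y : ↥U}
    (hkm : IsIntMatrix (((k : ↥U) : GL (Fin N) K) : Matrix (Fin N) (Fin N) K))
    (hkim : IsIntMatrix ((((k : ↥U) : GL (Fin N) K)⁻¹ : GL (Fin N) K) : Matrix (Fin N) (Fin N) K)) :
    IsIntMatrix (c • (((((k⁻¹ * y * k : ↥U)) : GL (Fin N) K) : Matrix (Fin N) (Fin N) K) - 1)) ↔
      IsIntMatrix (c • (((((y : ↥U)) : GL (Fin N) K) : Matrix (Fin N) (Fin N) K) - 1)) := by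
  have e : ((((k⁻¹ * y * k : ↥U)) : GL (Fin N) K) : Matrix (Fin N) (Fin N) K) =
      ((((k : ↥U) : GL (Fin N) K)⁻¹ : GL (Fin N) K) : Matrix (Fin N) (Fin N) K) * ((((y : ↥U)) : GL (Fin N) K) : Matrix (Fin N) (Fin N) K) *
        (((k : ↥U) : GL (Fin N) K) : Matrix (Fin N) (Fin N) K) := by
    rw [Subgroup.coe_mul, Subgroup.coe_mul, Subgroup.coe_inv, Units.val_mul, Units.val_mul]
  rw [e]
  constructor
  · intro h
    have h' := isIntMatrix_smul_conj_sub_one c hkm hkim (Units.mul_inv _) h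
    rwa [← mul_assoc, ← mul_assoc, Units.mul_inv, one_mul, mul_assoc, Units.mul_inv, mul_one] at h'
  · intro h
    exact isIntMatrix_smul_conj_sub_one c hkim hkm (Units.inv_mul _) h

/-- **LEVEL `c` AS A LATTICE TOKEN**: for `γ g ∈ GL_N(K)` and `c ≠ 0`, `IsIntMatrix (c⁻¹ • (g⁻¹γg − 1)) ↔ (γ − 1)·(g·L₀) ⊆ c·(g·L₀)`
(★ `map_sub_one_latt_le_scaleLattice_iff`; the level-`c` twin of ★ `rank_redMat_sub_one_eq_zero_iff_map_sub_one_le`). [cite: Kottwitz1986BaseChangeUnits, §2 pp. 244–247] -/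
theorem isIntMatrix_inv_smul_conj_sub_one_iff_map_sub_one_le {c : K} (hc : c ≠ 0) (γ g : GL (Fin N) K) :
    IsIntMatrix (c⁻¹ • ((((g⁻¹ * γ * g : GL (Fin N) K)) : Matrix (Fin N) (Fin N) K) - 1)) ↔
      (mapGL g (stdLattice K N)).map ((Matrix.toLin' ((γ : Matrix (Fin N) (Fin N) K) - 1)).restrictScalars (Valued.integer K)) ≤ scaleLattice c (mapGL g (stdLattice K N)) := by
  change _ ↔ (latt (g : Matrix (Fin N) (Fin N) K)).map _ ≤ scaleLattice c (latt (g : Matrix (Fin N) (Fin N) K))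
  rw [map_sub_one_latt_le_scaleLattice_iff hc γ g]
  refine forall_congr' fun i => forall_congr' fun k => ?_
  rw [Matrix.smul_apply, smul_eq_mul]
  exact v_inv_mul_le_one_iff hc

end Tokens

variable (L : Type) [Field L] [NumberField L] [IsCMField L] (H' : Matrix (Fin 3) (Fin 3) L)
  {v : HeightOneSpectrum (𝓞 ↥(maximalRealSubfield L))}

set_option synthInstance.maxHeartbeats 200000 in
set_option maxHeartbeats 1600000 in
-- the strata set, the coset spaces of the one-place model and the lattice set are large terms (★ `…UnitRow` ∕ ★ (B2b-I) budgets)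
open scoped Classical in
/-- **(B2f) THE LEVEL-TWO FIXED COSETS ARE A LEVEL-TWO PLACE COUNT (2-free).**  For `δ ∈ G′_v` deep at a non-split place `w ∣ v` UNRAMIFIED in `L` (any residue
characteristic), any frame `T ∈ GL₃(𝒪_w)` with `H′_w = ᵗ(σ_wT)·J₀·T`, and a uniformiser `ϖ` (`|ϖ| = exp(−1)`):
`#{q ∈ Fix_δ(G′_v ⧸ K′) : (q⁻¹δq)_w ≡ 1 (mod ϖ²)} = #{M ⊆ L_w³ : M a J₀-self-dual 𝒪_w-lattice, (Tδ_wT⁻¹)·M ⊆ M, (Tδ_wT⁻¹ − 1)·M ⊆ ϖ²·M}` — the level-two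
twin of ★ (B2c-I) `ncard_rankStrata_zero_eq_ncard_isSelfDualLattice_stable_level_of_frame` (the row-0 predicate `rank(red(q⁻¹δq) − 1) = 0` ↦ `IsIntMatrix ((ϖ²)⁻¹ • ((q⁻¹δq)_w − 1))`,
the level token `ϖ` ↦ `ϖ²`); right side = ★ (W2) `cast_ncard_vertex_levelTwo_eq_of_total`'s level set. [cite: Rogawski1990, §4.9 p. 54, Prop. 4.9.1 (b) p. 55]
[cite: Kottwitz1986BaseChangeUnits, §1 pp. 240–241] [cite: Flicker1998UnitaryFL, §3 Prop. 5 p. 82] -/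
theorem ncard_fixedBy_levelTwo_eq_ncard_isSelfDualLattice_stable_levelTwo_of_frame (w : PlacesOver L v)
    (hw : IsCMField.complexConj L • w.1 = w.1) (hv : Algebra.IsUnramifiedIn (𝓞 L) v.asIdeal)
    (δ : (cmDatum L 3 H').Local v)
    (ht : ∀ m : ℕ, ValuativeRel.valuation (w.1.adicCompletion L)
      (((((δ.val : GL (Fin 3) (LocalRing L v)).val.map (Pi.evalRingHom (fun w' : UnitaryGroup.PlacesOver L v => w'.1.adicCompletion L) w))).charpoly -
        (Polynomial.X - 1) ^ 3).coeff m) < 1)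
    (T : GL (Fin 3) (w.1.adicCompletion L)) (hTint : T ∈ glInt 3 (w.1.adicCompletion L))
    (hJT : placeForm H' w.1 = formCongr (galAdicCompletionMap (L := L) (IsCMField.complexConj L) hw) T ((StdForm.antidiagonal 3).over (w.1.adicCompletion L)))
    {ϖ : w.1.adicCompletion L} (hϖ : Valued.v ϖ = WithZero.exp (-1 : ℤ)) :
    {q : (cmDatum L 3 H').Local v ⧸ cmLocalIntegralLevel L 3 H' v |
        q ∈ MulAction.fixedBy ((cmDatum L 3 H').Local v ⧸ cmLocalIntegralLevel L 3 H' v) δ ∧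
          IsIntMatrix ((ϖ ^ 2)⁻¹ • ((((q.out⁻¹ * δ * q.out : (cmDatum L 3 H').Local v)).val : GL (Fin 3) (LocalRing L v)).val.map
            (Pi.evalRingHom (fun w' : UnitaryGroup.PlacesOver L v => w'.1.adicCompletion L) w) - 1))}.ncard =
      {M : Submodule (Valued.integer (w.1.adicCompletion L)) (Fin 3 → w.1.adicCompletion L) |
        IsSelfDualLattice (galAdicCompletionMap (L := L) (IsCMField.complexConj L) hw) ϖ ((StdForm.antidiagonal 3).over (w.1.adicCompletion L)) M ∧
          M.map ((Matrix.toLin' ((T : Matrix (Fin 3) (Fin 3) (w.1.adicCompletion L)) *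
            ((δ.val : GL (Fin 3) (LocalRing L v)) : Matrix (Fin 3) (Fin 3) (LocalRing L v)).map
              (Pi.evalRingHom (fun w' : UnitaryGroup.PlacesOver L v => w'.1.adicCompletion L) w) *
            ((T⁻¹ : GL (Fin 3) (w.1.adicCompletion L)) : Matrix (Fin 3) (Fin 3) (w.1.adicCompletion L)))).restrictScalars
              (Valued.integer (w.1.adicCompletion L))) ≤ M ∧
          M.map ((Matrix.toLin' ((T : Matrix (Fin 3) (Fin 3) (w.1.adicCompletion L)) *
            ((δ.val : GL (Fin 3) (LocalRing L v)) : Matrix (Fin 3) (Fin 3) (LocalRing L v)).map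
              (Pi.evalRingHom (fun w' : UnitaryGroup.PlacesOver L v => w'.1.adicCompletion L) w) *
            ((T⁻¹ : GL (Fin 3) (w.1.adicCompletion L)) : Matrix (Fin 3) (Fin 3) (w.1.adicCompletion L)) - 1)).restrictScalars
              (Valued.integer (w.1.adicCompletion L))) ≤ scaleLattice (ϖ ^ 2) M}.ncard := by
  classical
  have hc1 : IsCMField.complexConj L ≠ 1 := IsCMField.complexConj_ne_one L
  haveI : Algebra.IsQuadraticExtension ↥(maximalRealSubfield L) L := IsCMField.isQuadraticExtension L
  haveI : IsAdicComplete (IsLocalRing.maximalIdeal (Valued.integer (w.1.adicCompletion L))) (Valued.integer (w.1.adicCompletion L)) :=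
    isAdicComplete_maximalIdeal_valuedInteger_adicCompletion L w.1
  set σ : w.1.adicCompletion L →+* w.1.adicCompletion L := galAdicCompletionMap (L := L) (IsCMField.complexConj L) hw with hσdef
  set ev := Pi.evalRingHom (fun w' : PlacesOver L v => w'.1.adicCompletion L) w with hev
  have hσσ : ∀ x, σ (σ x) = x := galAdicCompletionMap_galAdicCompletionMap_of_smul_eq (IsCMField.complexConj L) w hc1 hw
  have hvσ : ∀ x, Valued.v (σ x) = Valued.v x := fun x => valued_galAdicCompletionMap (L := L) (IsCMField.complexConj L) hw x
  -- ### (1) ★ B-p12 (α): the frame `e g = T g_w T⁻¹` onto the one-place model `U = U(σ_w, Φ₃)`, `K_v ↔ U ∩ GL₃(𝒪_w)`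
  have hF : formCongr σ T (placeForm (Matrix.of fun i j : Fin 3 => if i.val + j.val + 1 = 3 then (1 : L) else 0) w.1) =
      (1 : w.1.adicCompletion L) • placeForm H' w.1 := by
    rw [one_smul, placeForm_antidiagOne, ← hJT]
  set e := (localNonsplitCongr (IsCMField.complexConj L) hc1 w hw T isUnit_one hF).trans
    (localNonsplitEquiv (IsCMField.complexConj L) (Matrix.of fun i j : Fin 3 => if i.val + j.val + 1 = 3 then (1 : L) else 0) hc1 w hw) with he
  have hform : ∀ g, ((e g).val : GL (Fin 3) (w.1.adicCompletion L)) =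
      T * ((localNonsplitEquiv (IsCMField.complexConj L) H' hc1 w hw g).val : GL (Fin 3) (w.1.adicCompletion L)) * T⁻¹ :=
    fun g => (congrArg (fun x : ↥(unitaryGroupOfForm (galAdicCompletionMap (L := L) (IsCMField.complexConj L) hw)
        (placeForm (Matrix.of fun i j : Fin 3 => if i.val + j.val + 1 = 3 then (1 : L) else 0) w.1)) => (x.val : GL (Fin 3) (w.1.adicCompletion L)))
          (ContinuousMulEquiv.trans_apply _ _ g)).trans
      (localNonsplitEquiv_localNonsplitCongr (IsCMField.complexConj L) hc1 w hw T isUnit_one hF g)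
  have hlev : ∀ g, g ∈ cmLocalIntegralLevel L 3 H' v ↔ ((e g).val : GL (Fin 3) (w.1.adicCompletion L)) ∈ glInt 3 (w.1.adicCompletion L) :=
    fun g => (hform g).symm ▸ mem_cmLocalIntegralLevel_iff_conj_mem_glInt L H' w hw hTint g
  have hcoe : ∀ g : (cmDatum L 3 H').Local v, (((localNonsplitEquiv (IsCMField.complexConj L) H' hc1 w hw g :
      ↥(unitaryGroupOfForm (galAdicCompletionMap (L := L) (IsCMField.complexConj L) hw) (placeForm H' w.1))) : GL (Fin 3) (w.1.adicCompletion L)) :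
        Matrix (Fin 3) (Fin 3) (w.1.adicCompletion L)) = ((g.val : GL (Fin 3) (LocalRing L v)).val).map ev := fun g => rfl
  have hxw : ∀ g : (cmDatum L 3 H').Local v, g ∈ cmLocalIntegralLevel L 3 H' v →
      ((localNonsplitEquiv (IsCMField.complexConj L) H' hc1 w hw g).val : GL (Fin 3) (w.1.adicCompletion L)) ∈ glInt 3 (w.1.adicCompletion L) :=
    fun g hg => (mem_localIntegralLevel_iff_of_smul_eq (IsCMField.complexConj L) 3 H' hc1 w hw g).1 hg
  -- the Jordan rank is read on `K_v` only, where the frame conjugates by `T⁻¹ ∈ GL₃(𝒪_w)`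
  have hR : ∀ g : (cmDatum L 3 H').Local v, g ∈ cmLocalIntegralLevel L 3 H' v →
      (IsIntMatrix ((ϖ ^ 2)⁻¹ • ((((g.val : GL (Fin 3) (LocalRing L v)).val).map ev) - 1)) ↔
        IsIntMatrix ((ϖ ^ 2)⁻¹ • (((((e g).val : GL (Fin 3) (w.1.adicCompletion L))) : Matrix (Fin 3) (Fin 3) (w.1.adicCompletion L)) - 1))) := by
    intro g _
    have hTm : IsIntMatrix (T : Matrix (Fin 3) (Fin 3) (w.1.adicCompletion L)) := fun a b =>
      (v_le_one_iff_valuation_le_one _).2 ((Valuation.mem_integer_iff _ _).1 (((mem_glInt_iff _).1 hTint).1 a b))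
    have hTim : IsIntMatrix (((T⁻¹ : GL (Fin 3) (w.1.adicCompletion L))) : Matrix (Fin 3) (Fin 3) (w.1.adicCompletion L)) := fun a b =>
      (v_le_one_iff_valuation_le_one _).2 ((Valuation.mem_integer_iff _ _).1 (((mem_glInt_iff _).1 hTint).2 a b))
    have key : ((((e g).val : GL (Fin 3) (w.1.adicCompletion L))) : Matrix (Fin 3) (Fin 3) (w.1.adicCompletion L)) =
        (T : Matrix (Fin 3) (Fin 3) (w.1.adicCompletion L)) * (((g.val : GL (Fin 3) (LocalRing L v)).val).map ev) *
          (((T⁻¹ : GL (Fin 3) (w.1.adicCompletion L))) : Matrix (Fin 3) (Fin 3) (w.1.adicCompletion L)) := by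
      rw [hform g, Units.val_mul, Units.val_mul, hcoe g]
    constructor
    · intro h
      rw [key]
      exact isIntMatrix_smul_conj_sub_one _ hTm hTim (Units.mul_inv T) h
    · intro h
      have h' := isIntMatrix_smul_conj_sub_one ((ϖ ^ 2)⁻¹) hTim hTm (Units.inv_mul T) h
      rwa [key, ← mul_assoc, ← mul_assoc, Units.inv_mul, one_mul, mul_assoc, Units.inv_mul, mul_one] at h'
  -- ### (2) transport of the stratum along `e` (★ `ncard_fixedBy_sep_congr`, the predicate carrying the `K`-membership it is read on)
  have hK : ∀ g : (cmDatum L 3 H').Local v, g ∈ cmLocalIntegralLevel L 3 H' v ↔ e.toMulEquiv g ∈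
      (glInt 3 (w.1.adicCompletion L)).subgroupOf (unitaryGroupOfForm σ (placeForm (Matrix.of fun i j : Fin 3 => if i.val + j.val + 1 = 3 then (1 : L) else 0) w.1)) :=
    fun g => by rw [Subgroup.mem_subgroupOf]; exact hlev g
  have hset : {q : (cmDatum L 3 H').Local v ⧸ cmLocalIntegralLevel L 3 H' v |
        q ∈ MulAction.fixedBy ((cmDatum L 3 H').Local v ⧸ cmLocalIntegralLevel L 3 H' v) δ ∧
          IsIntMatrix ((ϖ ^ 2)⁻¹ • ((((q.out⁻¹ * δ * q.out : (cmDatum L 3 H').Local v)).val : GL (Fin 3) (LocalRing L v)).val.map ev - 1))} =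
      {q : (cmDatum L 3 H').Local v ⧸ cmLocalIntegralLevel L 3 H' v |
        q ∈ MulAction.fixedBy ((cmDatum L 3 H').Local v ⧸ cmLocalIntegralLevel L 3 H' v) δ ∧
          ((q.out⁻¹ * δ * q.out : (cmDatum L 3 H').Local v) ∈ cmLocalIntegralLevel L 3 H' v ∧
            IsIntMatrix ((ϖ ^ 2)⁻¹ • ((((q.out⁻¹ * δ * q.out : (cmDatum L 3 H').Local v)).val : GL (Fin 3) (LocalRing L v)).val.map ev - 1)))} := by
    ext q
    simp only [Set.mem_setOf_eq]
    refine ⟨fun ⟨hq, hr⟩ => ⟨hq, ?_, hr⟩, fun ⟨hq, _, hr⟩ => ⟨hq, hr⟩⟩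
    rw [← QuotientGroup.out_eq' q] at hq
    exact (mem_fixedBy_quotient_mk_iff (cmLocalIntegralLevel L 3 H' v) δ q.out).1 hq
  have step1 := ncard_fixedBy_sep_congr (cmLocalIntegralLevel L 3 H' v)
    ((glInt 3 (w.1.adicCompletion L)).subgroupOf (unitaryGroupOfForm σ (placeForm (Matrix.of fun i j : Fin 3 => if i.val + j.val + 1 = 3 then (1 : L) else 0) w.1)))
    e.toMulEquiv hK δ
    (fun g => g ∈ cmLocalIntegralLevel L 3 H' v ∧ IsIntMatrix ((ϖ ^ 2)⁻¹ • ((((g.val : GL (Fin 3) (LocalRing L v)).val).map ev) - 1)))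
    (fun y => y ∈ (glInt 3 (w.1.adicCompletion L)).subgroupOf (unitaryGroupOfForm σ (placeForm (Matrix.of fun i j : Fin 3 => if i.val + j.val + 1 = 3 then (1 : L) else 0) w.1)) ∧
      IsIntMatrix ((ϖ ^ 2)⁻¹ • ((((y : ↥(unitaryGroupOfForm σ (placeForm (Matrix.of fun i j : Fin 3 => if i.val + j.val + 1 = 3 then (1 : L) else 0) w.1))) :
        GL (Fin 3) (w.1.adicCompletion L)) : Matrix (Fin 3) (Fin 3) (w.1.adicCompletion L)) - 1)))
    (fun g => ⟨fun ⟨hg, hr⟩ => ⟨(hK g).1 hg, (hR g hg).1 hr⟩, fun ⟨hg, hr⟩ => ⟨(hK g).2 hg, (hR g ((hK g).2 hg)).2 hr⟩⟩)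
    (fun k' hk' y hy => by
      rw [Subgroup.mem_subgroupOf] at hk' hy
      refine and_congr ⟨fun _ => Subgroup.mem_subgroupOf.2 hy, fun _ => Subgroup.mem_subgroupOf.2 ?_⟩ (isIntMatrix_smul_coe_conj_sub_one_iff _ _
        (fun a b => (v_le_one_iff_valuation_le_one _).2 ((Valuation.mem_integer_iff _ _).1 (((mem_glInt_iff _).1 hk').1 a b)))
        (fun a b => (v_le_one_iff_valuation_le_one _).2 ((Valuation.mem_integer_iff _ _).1 (((mem_glInt_iff _).1 hk').2 a b))))
      rw [Subgroup.coe_mul, Subgroup.coe_mul, Subgroup.coe_inv]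
      exact mul_mem (mul_mem (inv_mem hk') hy) hk')
  -- ### (3) the strata dictionary on `U ⧸ (U ∩ GL₃(𝒪_w))` (2-free inputs: `L₀` self-dual, `U` transitive), rank `0` = the level-one token
  have hJ0 : placeForm (Matrix.of fun i j : Fin 3 => if i.val + j.val + 1 = 3 then (1 : L) else 0) w.1 =
      (StdForm.antidiagonal 3).over (w.1.adicCompletion L) := by rw [placeForm_antidiagOne]
  have hJ0det : (placeForm (Matrix.of fun i j : Fin 3 => if i.val + j.val + 1 = 3 then (1 : L) else 0) w.1).det ≠ 0 := by
    rw [hJ0]; exact ((Matrix.isUnit_iff_isUnit_det _).1 ((StdForm.antidiagonal 3).isUnit_over _)).ne_zero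
  have hL₀ : IsSelfDualLattice σ ϖ (placeForm (Matrix.of fun i j : Fin 3 => if i.val + j.val + 1 = 3 then (1 : L) else 0) w.1)
      (stdLattice (w.1.adicCompletion L) 3) := by
    rw [hJ0]; exact isSelfDualLattice_stdLattice_three_of_v hϖ
  have htrace : ∃ t : w.1.adicCompletion L, Valued.v t ≤ 1 ∧ t + σ t = 1 := by
    let σO := (galAdicCompletionMap (L := L) (IsCMField.complexConj L) hw).restrict (ValuativeRel.valuation (w.1.adicCompletion L)).integer _
      fun x hx => galAdicCompletionMap_mem_integer (IsCMField.complexConj L) w hw hx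
    obtain ⟨t, ht1⟩ := exists_add_map_eq_one_integer (IsCMField.complexConj L) w hc1 hw hv σO (fun _ => rfl) fun x => Subtype.ext (hσσ x)
    exact ⟨t, (v_le_one_iff_mem_integer (t : w.1.adicCompletion L)).2 t.2, congrArg Subtype.val ht1⟩
  have htrans : ∀ M : Submodule (Valued.integer (w.1.adicCompletion L)) (Fin 3 → w.1.adicCompletion L),
      IsSelfDualLattice σ ϖ (placeForm (Matrix.of fun i j : Fin 3 => if i.val + j.val + 1 = 3 then (1 : L) else 0) w.1) M →
        ∃ u : ↥(unitaryGroupOfForm σ (placeForm (Matrix.of fun i j : Fin 3 => if i.val + j.val + 1 = 3 then (1 : L) else 0) w.1)),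
          M = mapGL ((u : ↥(unitaryGroupOfForm σ (placeForm (Matrix.of fun i j : Fin 3 => if i.val + j.val + 1 = 3 then (1 : L) else 0) w.1))) :
            GL (Fin 3) (w.1.adicCompletion L)) (stdLattice (w.1.adicCompletion L) 3) := by
    rw [hJ0]
    intro M hM
    obtain ⟨u, hu⟩ := exists_unitary_mapGL_stdLattice_eq_of_isSelfDualLattice_of_trace hσσ hvσ hϖ htrace hM
    exact ⟨u, hu.symm⟩
  have step2 := ncard_fixedBy_quotient_sep_eq_ncard_selfDual_fixed_sep σ ϖ _ hL₀ htrans (e δ)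
    (fun y => y ∈ (glInt 3 (w.1.adicCompletion L)).subgroupOf (unitaryGroupOfForm σ (placeForm (Matrix.of fun i j : Fin 3 => if i.val + j.val + 1 = 3 then (1 : L) else 0) w.1)) ∧
      IsIntMatrix ((ϖ ^ 2)⁻¹ • ((((y : ↥(unitaryGroupOfForm σ (placeForm (Matrix.of fun i j : Fin 3 => if i.val + j.val + 1 = 3 then (1 : L) else 0) w.1))) :
        GL (Fin 3) (w.1.adicCompletion L)) : Matrix (Fin 3) (Fin 3) (w.1.adicCompletion L)) - 1)))
    (fun M => M.map ((Matrix.toLin' ((((e δ).val : GL (Fin 3) (w.1.adicCompletion L)) : Matrix (Fin 3) (Fin 3) (w.1.adicCompletion L)) - 1)).restrictScalars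
      (Valued.integer (w.1.adicCompletion L))) ≤ scaleLattice (ϖ ^ 2) M)
    (fun g hmem => by
      have hu : (((g : ↥(unitaryGroupOfForm σ (placeForm (Matrix.of fun i j : Fin 3 => if i.val + j.val + 1 = 3 then (1 : L) else 0) w.1))) :
          GL (Fin 3) (w.1.adicCompletion L)))⁻¹ * ((e δ).val : GL (Fin 3) (w.1.adicCompletion L)) * (g : GL (Fin 3) (w.1.adicCompletion L)) ∈
            glInt 3 (w.1.adicCompletion L) := by
        rw [Subgroup.coe_mul, Subgroup.coe_mul, Subgroup.coe_inv] at hmem; exact hmem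
      rw [and_iff_right (Subgroup.mem_subgroupOf.2 hmem), Subgroup.coe_mul, Subgroup.coe_mul, Subgroup.coe_inv]
      exact isIntMatrix_inv_smul_conj_sub_one_iff_map_sub_one_le (pow_ne_zero 2 (isUniformizingElement_of_v_eq hϖ).ne_zero) _ _)
  -- ### (4) `eδ·M = M ⟺ eδ·M ⊆ M` (`|det| = 1`, `χ` integral since `δ` is deep), and the frame matrix `T δ_w T⁻¹`
  have hdet := v_det_eq_one_of_mem_unitaryGroupOfForm hvσ hJ0det (e δ).2
  have hmat : (((e δ).val : GL (Fin 3) (w.1.adicCompletion L)) : Matrix (Fin 3) (Fin 3) (w.1.adicCompletion L)) =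
      (T : Matrix (Fin 3) (Fin 3) (w.1.adicCompletion L)) *
        ((δ.val : GL (Fin 3) (UnitaryGroup.LocalRing L v)) : Matrix (Fin 3) (Fin 3) (UnitaryGroup.LocalRing L v)).map ev *
        ((T⁻¹ : GL (Fin 3) (w.1.adicCompletion L)) : Matrix (Fin 3) (Fin 3) (w.1.adicCompletion L)) := by
    rw [hform δ, Units.val_mul, Units.val_mul]
    rfl
  have hint : ∀ i, ((((e δ).val : GL (Fin 3) (w.1.adicCompletion L))) : Matrix (Fin 3) (Fin 3) (w.1.adicCompletion L)).charpoly.coeff i ∈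
      Valued.integer (w.1.adicCompletion L) := by
    intro i
    rw [hmat, Matrix.coe_units_inv, Matrix.charpoly_units_conj, valuedInteger_eq_integer, ← hcoe δ]
    exact charpoly_coeff_mem_integer_of_deep
      ((localNonsplitEquiv (IsCMField.complexConj L) H' hc1 w hw δ :
        ↥(unitaryGroupOfForm (galAdicCompletionMap (L := L) (IsCMField.complexConj L) hw) (placeForm H' w.1))) :
          GL (Fin 3) (w.1.adicCompletion L)) ht i
  rw [hset, step1]
  -- `e.toMulEquiv δ` is `e δ` by `rfl`
  calc _ = _ := step2
    _ = _ := by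
      congr 1
      ext M
      simp only [Set.mem_setOf_eq]
      rw [mapGL_eq_iff_map_le_of_charpoly_coeff_mem M hdet hint, hmat, hJ0]

end Literature.NumberTheory.Rogawski1990

end
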